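import Mathlib
import Summits.Ventures.PercRepro2.StarGlue
import Summits.Ventures.PercRepro2.TypedFactor
import Summits.Ventures.PercRepro2.TypedSepThreeSym
import Summits.Ventures.PercRepro2.TypedSplit
import Summits.Ventures.PercRepro2.TypedUntouched
import Summits.Ventures.PercRepro2.HCovTyped
import Summits.Ventures.PercRepro2.OStarModel

/-!
# The star of `o` and the glued state (blind cell PercRepro2, mine-2 g39, 2026-08-28;
`proofs/MINE2-GLUE.md` §3, row M2-83 — part I of the gluing lemma)

The star gadget at the pole `o` with (at most) one edge to each of `a₁`, `a₂`, `b` (`Star`: three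
optional edges, no other edge at `o`, the marks distinct as needed), its open-neighbour set
`nbr x`, and the rest's connection pattern `pat x` on the four marks `a₁, a₂, a₃, b` with the
star closed (night-1's `StarGlue.closeStar`).  **`Star.st_eq_S`** — THE GLUING LEMMA FOR STATES:
the state of a copy is the glued state `S (pat x) (nbr x)` of `OStarModel.lean`, from night-1's
glue lemma `conn_iff_glue` (two marks are joined iff joined in the rest or both reaching an open
neighbour of `o`) and `conn_a3_iff_glue` (`o` is joined to a mark iff an open neighbour reaches it),
with `Star.openAdj_iff` (an open edge at `o` is an open slot).  `valid_pat`: the pattern is a set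
partition.  The two sides of a typed set: `sideA` (the typed edges at `o`) and `sideB` (the
rest); the neighbour set only sees `sideA` (`nbr_restr_sideA`), the pattern only `sideB`
(`pat_restr_sideB`).  Part II (`OStarGlueSum.lean`) carries out the typed sums, part III
(`OStarGlue.lean`) assembles the theorem.  Own code; standard axioms.
-/

namespace Summit.Ventures.PercRepro2

open UnionCluster

namespace CovForm

namespace OStar

open OneTyped Untouched TypedFactor SepThree TypedRed StarGlue

/-! ## The star and its neighbour sets -/

section Star

variable {V : Type*} {E : Type*}

/-- The value of an optional edge in a configuration (`false` when absent). -/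
def val : Option E → Config E → Bool
  | none, _ => false
  | some e, x => x e

/-- The configuration updated at an optional edge (unchanged when absent). -/
def updO [DecidableEq E] : Option E → Config E → Bool → Config E
  | none, x, _ => x
  | some e, x, a => Function.update x e a

/-- A finite edge set with an optional edge erased. -/
def eraseO [DecidableEq E] : Option E → Finset E → Finset E
  | none, A => A
  | some e, A => A.erase e

/-- The type of an optional star edge: `0` when absent, `τ e` when typed, `3` / `0` when pinned
open / closed. -/
def typ [DecidableEq E] (s : Option E) (A : Finset E) (z : Config E) (τ : E → ℕ) : ℕ :=
  match s with
  | none => 0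
  | some e => if e ∈ A then τ e else if z e then 3 else 0

/-- **The explicit star of `o`**: optional edges `o–a₁`, `o–a₂`, `o–b`, no other edge at `o`, the
marks distinct as needed. -/
structure Star (ends : E → Sym2 V) (o a₁ a₂ a₃ b : V) (e₁ e₂ eb : Option E) : Prop where
  h₁ : ∀ e, e₁ = some e → ends e = s(o, a₁)
  h₂ : ∀ e, e₂ = some e → ends e = s(o, a₂)
  hb : ∀ e, eb = some e → ends e = s(o, b)
  all : ∀ e, o ∈ ends e → e₁ = some e ∨ e₂ = some e ∨ eb = some e
  o1 : o ≠ a₁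
  o2 : o ≠ a₂
  o3 : o ≠ a₃
  ob : o ≠ b
  a12 : a₁ ≠ a₂
  a1b : a₁ ≠ b
  a2b : a₂ ≠ b

variable {ends : E → Sym2 V} {o a₁ a₂ a₃ b : V} {e₁ e₂ eb : Option E}

/-- The star edges are at `o`. -/
lemma Star.mem_of_slot (hS : Star ends o a₁ a₂ a₃ b e₁ e₂ eb) {e : E}
    (h : e₁ = some e ∨ e₂ = some e ∨ eb = some e) : o ∈ ends e := by
  rcases h with h | h | h
  · rw [hS.h₁ e h]; exact Sym2.mem_mk_left _ _
  · rw [hS.h₂ e h]; exact Sym2.mem_mk_left _ _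
  · rw [hS.hb e h]; exact Sym2.mem_mk_left _ _

/-- The slots are distinct edges. -/
lemma Star.ne12 (hS : Star ends o a₁ a₂ a₃ b e₁ e₂ eb) {e e' : E} (h : e₁ = some e)
    (h' : e₂ = some e') : e ≠ e' := by
  rintro rfl
  have := (hS.h₁ e h).symm.trans (hS.h₂ e h')
  rw [Sym2.eq_iff] at this
  rcases this with ⟨_, h12⟩ | ⟨h1, _⟩
  · exact hS.a12 h12
  · exact hS.o2 h1

/-- The slots are distinct edges. -/
lemma Star.ne1b (hS : Star ends o a₁ a₂ a₃ b e₁ e₂ eb) {e e' : E} (h : e₁ = some e)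
    (h' : eb = some e') : e ≠ e' := by
  rintro rfl
  have := (hS.h₁ e h).symm.trans (hS.hb e h')
  rw [Sym2.eq_iff] at this
  rcases this with ⟨_, h1b⟩ | ⟨h1, _⟩
  · exact hS.a1b h1b
  · exact hS.ob h1

/-- The slots are distinct edges. -/
lemma Star.ne2b (hS : Star ends o a₁ a₂ a₃ b e₁ e₂ eb) {e e' : E} (h : e₂ = some e)
    (h' : eb = some e') : e ≠ e' := by
  rintro rfl
  have := (hS.h₂ e h).symm.trans (hS.hb e h')
  rw [Sym2.eq_iff] at this
  rcases this with ⟨_, h2b⟩ | ⟨h2, _⟩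
  · exact hS.a2b h2b
  · exact hS.ob h2

/-- The open-neighbour set of `o` in a configuration. -/
def nbr (e₁ e₂ eb : Option E) (x : Config E) : Nb := (val e₁ x, val e₂ x, val eb x)

/-- The marks `a₁, a₂, a₃, b` indexed by `Fin 4`. -/
def mark (a₁ a₂ a₃ b : V) : Fin 4 → V
  | 0 => a₁
  | 1 => a₂
  | 2 => a₃
  | 3 => b

/-- No mark is `o`. -/
lemma Star.mark_ne (hS : Star ends o a₁ a₂ a₃ b e₁ e₂ eb) (i : Fin 4) :
    mark a₁ a₂ a₃ b i ≠ o := by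
  fin_cases i
  · exact hS.o1.symm
  · exact hS.o2.symm
  · exact hS.o3.symm
  · exact hS.ob.symm

/-- **Open adjacency to `o` is an open slot.** -/
lemma Star.openAdj_iff (hS : Star ends o a₁ a₂ a₃ b e₁ e₂ eb) (x : Config E) (m : V) :
    OpenAdj ends x o m ↔
      (val e₁ x = true ∧ m = a₁) ∨ (val e₂ x = true ∧ m = a₂) ∨ (val eb x = true ∧ m = b) := by
  constructor
  · rintro ⟨e, he, hends⟩
    have ho : o ∈ ends e := by rw [hends]; exact Sym2.mem_mk_left _ _
    rcases hS.all e ho with h | h | h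
    · refine Or.inl ⟨by rw [h]; exact he, ?_⟩
      have := (hS.h₁ e h).symm.trans hends
      rw [Sym2.eq_iff] at this
      rcases this with ⟨_, h'⟩ | ⟨_, h'⟩
      · exact h'.symm
      · exact absurd h'.symm hS.o1
    · refine Or.inr (Or.inl ⟨by rw [h]; exact he, ?_⟩)
      have := (hS.h₂ e h).symm.trans hends
      rw [Sym2.eq_iff] at this
      rcases this with ⟨_, h'⟩ | ⟨_, h'⟩
      · exact h'.symm
      · exact absurd h'.symm hS.o2
    · refine Or.inr (Or.inr ⟨by rw [h]; exact he, ?_⟩)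
      have := (hS.hb e h).symm.trans hends
      rw [Sym2.eq_iff] at this
      rcases this with ⟨_, h'⟩ | ⟨_, h'⟩
      · exact h'.symm
      · exact absurd h'.symm hS.ob
  · rintro (⟨hv, rfl⟩ | ⟨hv, rfl⟩ | ⟨hv, rfl⟩)
    · cases h : e₁ with
      | none => rw [h] at hv; exact absurd hv Bool.false_ne_true
      | some e => exact ⟨e, by rw [h] at hv; exact hv, hS.h₁ e h⟩
    · cases h : e₂ with
      | none => rw [h] at hv; exact absurd hv Bool.false_ne_true
      | some e => exact ⟨e, by rw [h] at hv; exact hv, hS.h₂ e h⟩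
    · cases h : eb with
      | none => rw [h] at hv; exact absurd hv Bool.false_ne_true
      | some e => exact ⟨e, by rw [h] at hv; exact hv, hS.hb e h⟩

end Star

/-! ## The pattern of the rest and the glued state -/

section Pattern

variable {V : Type*} {E : Type*}
variable (ends : E → Sym2 V) (o a₁ a₂ a₃ b : V) [DecidablePred (· ∈ (touches ends {o})ᶜ)]

open Classical in
/-- The connection pattern of the rest on the four marks: the star of `o` closed. -/
noncomputable def pat (x : Config E) : Pat :=
  (decide (Conn ends (closeStar ends o x) a₁ a₂), decide (Conn ends (closeStar ends o x) a₁ a₃),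
    decide (Conn ends (closeStar ends o x) a₁ b), decide (Conn ends (closeStar ends o x) a₂ a₃),
    decide (Conn ends (closeStar ends o x) a₂ b), decide (Conn ends (closeStar ends o x) a₃ b))

variable {ends o a₁ a₂ a₃ b}

/-- The pattern's bits are the rest's connections between the marks. -/
lemma connP_pat (x : Config E) (i j : Fin 4) :
    connP (pat ends o a₁ a₂ a₃ b x) i j = true ↔
      Conn ends (closeStar ends o x) (mark a₁ a₂ a₃ b i) (mark a₁ a₂ a₃ b j) := by
  fin_cases i <;> fin_cases j <;>
    simp only [connP, pat, mark, decide_eq_true_eq, conn_refl] <;>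
    exact ⟨conn_symm, conn_symm⟩

variable {e₁ e₂ eb : Option E}

/-- A mark reaches an open neighbour of `o` iff `reach` says so. -/
lemma Star.reach_iff (hS : Star ends o a₁ a₂ a₃ b e₁ e₂ eb) (x : Config E) (i : Fin 4) :
    reach (pat ends o a₁ a₂ a₃ b x) (nbr e₁ e₂ eb x) i = true ↔
      ∃ m, OpenAdj ends x o m ∧ Conn ends (closeStar ends o x) (mark a₁ a₂ a₃ b i) m := by
  simp only [reach, nbr, Bool.or_eq_true, Bool.and_eq_true, connP_pat]
  constructor
  · rintro ((⟨hv, hc⟩ | ⟨hv, hc⟩) | ⟨hv, hc⟩)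
    · exact ⟨a₁, (hS.openAdj_iff x a₁).2 (Or.inl ⟨hv, rfl⟩), hc⟩
    · exact ⟨a₂, (hS.openAdj_iff x a₂).2 (Or.inr (Or.inl ⟨hv, rfl⟩)), hc⟩
    · exact ⟨b, (hS.openAdj_iff x b).2 (Or.inr (Or.inr ⟨hv, rfl⟩)), hc⟩
  · rintro ⟨m, hm, hc⟩
    rcases (hS.openAdj_iff x m).1 hm with ⟨hv, rfl⟩ | ⟨hv, rfl⟩ | ⟨hv, rfl⟩
    · exact Or.inl (Or.inl ⟨hv, hc⟩)
    · exact Or.inl (Or.inr ⟨hv, hc⟩)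
    · exact Or.inr ⟨hv, hc⟩

/-- The same, with the connection read from the neighbour. -/
lemma Star.reach_iff' (hS : Star ends o a₁ a₂ a₃ b e₁ e₂ eb) (x : Config E) (i : Fin 4) :
    reach (pat ends o a₁ a₂ a₃ b x) (nbr e₁ e₂ eb x) i = true ↔
      ∃ m, OpenAdj ends x o m ∧ Conn ends (closeStar ends o x) m (mark a₁ a₂ a₃ b i) := by
  rw [hS.reach_iff]
  constructor
  · rintro ⟨m, hm, hc⟩; exact ⟨m, hm, conn_symm hc⟩
  · rintro ⟨m, hm, hc⟩; exact ⟨m, hm, conn_symm hc⟩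

/-- **The glued connection between two marks** is the connection in the configuration. -/
lemma Star.connG_iff (hS : Star ends o a₁ a₂ a₃ b e₁ e₂ eb) (x : Config E) (i j : Fin 4) :
    connG (pat ends o a₁ a₂ a₃ b x) (nbr e₁ e₂ eb x) i j = true ↔
      Conn ends x (mark a₁ a₂ a₃ b i) (mark a₁ a₂ a₃ b j) := by
  rw [conn_iff_glue (hS.mark_ne i) (hS.mark_ne j)]
  simp only [connG, Bool.or_eq_true, Bool.and_eq_true, connP_pat]
  rw [hS.reach_iff x i, hS.reach_iff' x j]

/-- **The glued connection of `o` to a mark**. -/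
lemma Star.reach_iff_conn (hS : Star ends o a₁ a₂ a₃ b e₁ e₂ eb) (x : Config E) (i : Fin 4) :
    reach (pat ends o a₁ a₂ a₃ b x) (nbr e₁ e₂ eb x) i = true ↔
      Conn ends x (mark a₁ a₂ a₃ b i) o := by
  have hc : Conn ends x (mark a₁ a₂ a₃ b i) o ↔ Conn ends x o (mark a₁ a₂ a₃ b i) :=
    ⟨conn_symm, conn_symm⟩
  rw [hS.reach_iff', hc, conn_a3_iff_glue (hS.mark_ne i)]

/-- **The gluing lemma for states**: the state of a copy is the glued state of the rest's pattern
and the open-neighbour set of `o`. -/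
theorem Star.st_eq_S (hS : Star ends o a₁ a₂ a₃ b e₁ e₂ eb) (x : Config E) :
    st ends o a₁ a₂ a₃ b x = S (pat ends o a₁ a₂ a₃ b x) (nbr e₁ e₂ eb x) := by
  unfold st S
  simp only [Prod.mk.injEq]
  refine ⟨?_, ?_, ?_, ?_, ?_, ?_, ?_⟩
  · exact Bool.eq_iff_iff.2 (by simp only [decide_eq_true_eq]; exact (hS.connG_iff x 1 0).symm)
  · exact Bool.eq_iff_iff.2 (by simp only [decide_eq_true_eq]; exact (hS.reach_iff_conn x 0).symm)
  · exact Bool.eq_iff_iff.2 (by simp only [decide_eq_true_eq]; exact (hS.reach_iff_conn x 1).symm)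
  · exact Bool.eq_iff_iff.2 (by simp only [decide_eq_true_eq]; exact (hS.connG_iff x 0 3).symm)
  · exact Bool.eq_iff_iff.2 (by simp only [decide_eq_true_eq]; exact (hS.connG_iff x 1 3).symm)
  · exact Bool.eq_iff_iff.2 (by simp only [decide_eq_true_eq]; exact (hS.connG_iff x 0 2).symm)
  · exact Bool.eq_iff_iff.2 (by simp only [decide_eq_true_eq]; exact (hS.connG_iff x 1 2).symm)

/-- The rest's pattern is a set partition. -/
lemma valid_pat (x : Config E) : valid (pat ends o a₁ a₂ a₃ b x) = true := by
  have key : ∀ {p q r : Prop} {dp : Decidable p} {dq : Decidable q} {dr : Decidable r},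
      (p → q → r) → (p → r → q) → (q → r → p) →
        tri (@decide p dp) (@decide q dq) (@decide r dr) = true := by
    intro p q r dp dq dr h1 h2 h3
    by_cases hp : p <;> by_cases hq : q <;> by_cases hr : r <;> simp_all [tri]
  simp only [valid, pat, Bool.and_eq_true]
  refine ⟨⟨⟨key ?_ ?_ ?_, key ?_ ?_ ?_⟩, key ?_ ?_ ?_⟩, key ?_ ?_ ?_⟩ <;>
    intro h h' <;> first
    | exact conn_trans (conn_symm h) h'
    | exact conn_trans h (conn_symm h')
    | exact conn_trans h h'

end Pattern

/-! ## The two sides: the typed star edges and the other typed edges -/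

section Sides

variable {V : Type*} {E : Type*} [DecidableEq V] [DecidableEq E]
variable (ends : E → Sym2 V) (o : V)

/-- The typed edges at `o`. -/
def sideA (F : Finset E) : Finset E := F.filter fun e => o ∈ ends e

/-- The typed edges not at `o`. -/
def sideB (F : Finset E) : Finset E := F.filter fun e => o ∉ ends e

variable {ends o}

omit [DecidableEq E] in
/-- Membership in the star side. -/
lemma mem_sideA {F : Finset E} {e : E} : e ∈ sideA ends o F ↔ e ∈ F ∧ o ∈ ends e := by
  simp [sideA]

omit [DecidableEq E] in
/-- Membership in the rest side. -/
lemma mem_sideB {F : Finset E} {e : E} : e ∈ sideB ends o F ↔ e ∈ F ∧ o ∉ ends e := by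
  simp [sideB]

/-- The two sides partition the typed set. -/
lemma sideA_union_sideB (F : Finset E) : sideA ends o F ∪ sideB ends o F = F :=
  Finset.filter_union_filter_not_eq _ F

omit [DecidableEq E] in
/-- The two sides are disjoint. -/
lemma disjoint_sideA_sideB (F : Finset E) : Disjoint (sideA ends o F) (sideB ends o F) :=
  Finset.disjoint_filter_filter_not F F _

omit [DecidableEq E] in
/-- The star side is inside the typed set. -/
lemma sideA_subset (F : Finset E) : sideA ends o F ⊆ F := Finset.filter_subset _ _

omit [DecidableEq E] in
/-- The rest side is inside the typed set. -/
lemma sideB_subset (F : Finset E) : sideB ends o F ⊆ F := Finset.filter_subset _ _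

variable {a₁ a₂ a₃ b : V} {e₁ e₂ eb : Option E}

/-- The value of a star slot only sees the star side. -/
lemma val_restr_sideA (hS : Star ends o a₁ a₂ a₃ b e₁ e₂ eb) {s : Option E}
    (hs : ∀ e, s = some e → e₁ = some e ∨ e₂ = some e ∨ eb = some e) {F : Finset E}
    {z x : Config E} (hx : ∀ e, e ∉ F → x e = z e) :
    val s (restr (sideA ends o F) z x) = val s x := by
  cases s with
  | none => rfl
  | some e =>
    simp only [val]
    by_cases heF : e ∈ F
    · exact restr_of_mem (mem_sideA.2 ⟨heF, hS.mem_of_slot (hs e rfl)⟩)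
    · rw [restr_of_not_mem (fun h => heF (mem_sideA.1 h).1), hx e heF]

/-- The neighbour set only sees the star side. -/
lemma nbr_restr_sideA (hS : Star ends o a₁ a₂ a₃ b e₁ e₂ eb) {F : Finset E} {z x : Config E}
    (hx : ∀ e, e ∉ F → x e = z e) :
    nbr e₁ e₂ eb (restr (sideA ends o F) z x) = nbr e₁ e₂ eb x := by
  unfold nbr
  rw [val_restr_sideA hS (fun e h => Or.inl h) hx, val_restr_sideA hS (fun e h => Or.inr (Or.inl h)) hx,
    val_restr_sideA hS (fun e h => Or.inr (Or.inr h)) hx]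

variable [DecidablePred (· ∈ (touches ends {o})ᶜ)]

/-- Closing the star forgets the star side. -/
lemma closeStar_restr_sideB {F : Finset E} {z x : Config E} (hx : ∀ e, e ∉ F → x e = z e) :
    closeStar ends o (restr (sideB ends o F) z x) = closeStar ends o x := by
  funext e
  by_cases ho : o ∈ ends e
  · rw [closeStar_apply_of_mem ho, closeStar_apply_of_mem ho]
  · rw [closeStar_apply_of_not_mem ho, closeStar_apply_of_not_mem ho]
    by_cases heF : e ∈ F
    · exact restr_of_mem (mem_sideB.2 ⟨heF, ho⟩)
    · rw [restr_of_not_mem (fun h => heF (mem_sideB.1 h).1), hx e heF]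

/-- The pattern only sees the rest side. -/
lemma pat_restr_sideB {F : Finset E} {z x : Config E} (hx : ∀ e, e ∉ F → x e = z e) :
    pat ends o a₁ a₂ a₃ b (restr (sideB ends o F) z x) = pat ends o a₁ a₂ a₃ b x := by
  unfold pat
  rw [closeStar_restr_sideB hx]

end Sides

end OStar

end CovForm

end Summit.Ventures.PercRepro2
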